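import Mathlib
import HarnessLib
import Summits.Langlands.Langlands.Theorems.SatakeFamilyReach
import Literature.NumberTheory.Automorphic.Sweep1SymmetricPower
import Literature.NumberTheory.Automorphic.PairLFunctionBaseChange

/-!
# Satake-family reach vocabulary, §2 (definitions only): FUNCTORIAL DOORS — `LiftDoor`, `LiftShadow`, `LiftReach`
# (lens-3 g6 node `FunctorialReachSplit`; extends `Theorems/SatakeFamilyReach.lean` §1 in the same namespace)

Definitions ONLY.  `LiftDoor L n c`: the Satake family `c` is a.e. a print-functorial image of cuspidal L-algebraic data
of rank ≤ 3 — `Symᵐ(π) ⊗ χ`, m = 2, 3, 4 (tree `Literature.NumberTheory.Automorphic.symmPowerParams`;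
[cite: GelbartJacquet1978, Thm. 9.3] [cite: KimShahidi2002, Thm. B] [cite: Kim2003, Thm. B]), `π ⊠ π'` for
`GL₂ × GL₂` (tree `satakeTensor`; [cite: Ramakrishnan2000, Thm. M]) and `GL₂ × GL₃` ([cite: KimShahidi2002, Thm. A]);
`LiftShadow K n a`: linked (in 𝒢(K, n), or in 𝒢(L, n) after one solvable Galois `Link`) to a door vertex;
`LiftReach := Reach ∨ LiftShadow`.
-/

set_option linter.dupNamespace false
set_option linter.unusedVariables false

namespace Summit.Langlands.Langlands.Theorems.SatakeFamilyReach

open scoped Valued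
open Filter

section LiftDoors

variable {K : Type} [Field K] [NumberField K]

/-- LIFT DOOR (lens-3 g6, NEW): the rank-`n` Satake family `c` over `L` is, at almost every finite place, a
PRINT-FUNCTORIAL IMAGE of cuspidal `L`-algebraic automorphic data of rank ≤ 3 WHICH CARRY FULL COMPATIBLE FAMILIES
(`Full L 2 b`, `Full L 3 b'` of §1, read by the data: `π.1.HasSatakeParamAt w (b w)`) — a twisted symmetric power
`Symᵐ(π) ⊗ χ` of `GL₂`-data (`m = 2, 3, 4`, `n = m + 1`: Gelbart–Jacquet 1978, Kim–Shahidi 2002, Kim 2003; tree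
vocabulary `symmPowerParams`), or a Rankin–Selberg product `π ⊠ π'` of `GL₂ × GL₂`-data (`n = 4`: Ramakrishnan 2000,
tree `satakeTensor`, `Ramakrishnan2000_theoremM`) or of `GL₂ × GL₃`-data (`n = 6`: Kim–Shahidi 2002 Thm A).
The FULL input families make the transport PRINT in every case: either the lift is cuspidal (cuspidality criteria of
Gelbart–Jacquet / Kim–Shahidi / Ramakrishnan) or the Galois members of `c` are reducible (Chebotarev + Brauer–Nesbitt
against `Symᵐ ρ_b ⊗ χ`, `ρ_b ⊗ ρ_b'`), contradicting `Full L n c`.  (The wider doors WITHOUT input families are the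
tree's `FDoor` of `SatakeFamilyReachFunctorial.lean`; `LiftDoor → FDoor` in the g6 node.)  No door in ranks 1, 2
(`liftDoor_two_false` in the g6 node). -/
def LiftDoor (L : Type) [Field L] [NumberField L] (n : ℕ)
    (c : IsDedekindDomain.HeightOneSpectrum (NumberField.RingOfIntegers L) → Multiset ℂ) : Prop :=
  (∃ m : ℕ, (m = 2 ∨ m = 3 ∨ m = 4) ∧ n = m + 1 ∧ ∃ (π : Literature.NumberTheory.Automorphic.CuspidalAutomorphicRepData 2 L (Literature.NumberTheory.Automorphic.isCompact_glFiniteIntegralLevel_holds 2 L)) (χ : Literature.NumberTheory.Automorphic.CuspidalAutomorphicRepData 1 L (Literature.NumberTheory.Automorphic.isCompact_glFiniteIntegralLevel_holds 1 L)) (b : IsDedekindDomain.HeightOneSpectrum (NumberField.RingOfIntegers L) → Multiset ℂ), Full L 2 b ∧ π.1.IsLAlgebraic ∧ χ.1.IsLAlgebraic ∧ ∀ᶠ w : IsDedekindDomain.HeightOneSpectrum (NumberField.RingOfIntegers L) in cofinite, π.1.HasSatakeParamAt w (b w) ∧ ∃ x y t : ℂ, b w = {x, y} ∧ χ.1.HasSatakeParamAt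 w {t} ∧ c w = (Literature.NumberTheory.Automorphic.symmPowerParams m x y).map (t * ·)) ∨ (n = 4 ∧ ∃ (π π' : Literature.NumberTheory.Automorphic.CuspidalAutomorphicRepData 2 L (Literature.NumberTheory.Automorphic.isCompact_glFiniteIntegralLevel_holds 2 L)) (b b' : IsDedekindDomain.HeightOneSpectrum (NumberField.RingOfIntegers L) → Multiset ℂ), Full L 2 b ∧ Full L 2 b' ∧ π.1.IsLAlgebraic ∧ π'.1.IsLAlgebraic ∧ ∀ᶠ w : IsDedekindDomain.HeightOneSpectrum (NumberField.RingOfIntegers L) in cofinite, π.1.HasSatakeParamAt w (b w) ∧ π'.1.HasSatakeParamAt w (b' w) ∧ c w = Literature.NumberTheory.Automorphic.satakeTensor (b w) (b' w)) ∨ (n = 6 ∧ ∃ (π : Literature.NumberTheory.Automorphic.CuspidalAutomorphicRepData 2 L (Literature.NumberTheory.Automorphic.isCompact_glFiniteIntegralLevel_holds 2 L)) (π' : Literature.NumberTheory.Automorphic.CuspidalAutomorphicRepData 3 L (Literature.NumberTheory.Automorphic.isCompact_glFiniteIntegralLevel_holds 3 L)) (b b' : IsDedekindDomain.HeightOneSpectrum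 (NumberField.RingOfIntegers L) → Multiset ℂ), Full L 2 b ∧ Full L 3 b' ∧ π.1.IsLAlgebraic ∧ π'.1.IsLAlgebraic ∧ ∀ᶠ w : IsDedekindDomain.HeightOneSpectrum (NumberField.RingOfIntegers L) in cofinite, π.1.HasSatakeParamAt w (b w) ∧ π'.1.HasSatakeParamAt w (b' w) ∧ c w = Literature.NumberTheory.Automorphic.satakeTensor (b w) (b' w))

/-- LIFT SHADOW (lens-3 g6, NEW): `a` is LINKED in 𝒢(K, n) to a family passing a lift door, or — after ONE finite
Galois SOLVABLE `L/K` along a `Link` (g5) — linked in 𝒢(L, n) to such a family. -/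
def LiftShadow (K : Type) [Field K] [NumberField K] (n : ℕ)
    (a : IsDedekindDomain.HeightOneSpectrum (NumberField.RingOfIntegers K) → Multiset ℂ) : Prop :=
  (∃ c : IsDedekindDomain.HeightOneSpectrum (NumberField.RingOfIntegers K) → Multiset ℂ, Linked n a c ∧ LiftDoor K n c) ∨ ∃ (L : Type) (_ : Field L) (_ : NumberField L) (_ : Algebra K L), IsGalois K L ∧ IsSolvable (L ≃ₐ[K] L) ∧ ∃ b : IsDedekindDomain.HeightOneSpectrum (NumberField.RingOfIntegers L) → Multiset ℂ, Link K n a L b ∧ ∃ c : IsDedekindDomain.HeightOneSpectrum (NumberField.RingOfIntegers L) → Multiset ℂ, Linked n b c ∧ LiftDoor L n c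

/-- LIFT REACH (lens-3 g6, NEW): solvable reach (g5 `Reach`) OR a lift shadow. -/
def LiftReach (K : Type) [Field K] [NumberField K] (n : ℕ)
    (hcpt : Literature.NumberTheory.Automorphic.isCompact_glFiniteIntegralLevel n K)
    (a : IsDedekindDomain.HeightOneSpectrum (NumberField.RingOfIntegers K) → Multiset ℂ) : Prop :=
  Reach K n hcpt a ∨ LiftShadow K n a

end LiftDoors

end Summit.Langlands.Langlands.Theorems.SatakeFamilyReach
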